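import Summits.CriticalPhenomena.PercolationContinuityZ3.Theorems.Transplant.FKConnectivityAllQSlackFourPoint
import Mathlib.Analysis.SpecificLimits.Basic
import HarnessLib

/-!
# The TWO-CLUSTER corner of the `q < 1` column: `q → 0⁺` at fixed edge parameters turns `FourPointFK q` into a four-point inequality
# for Bernoulli percolation conditioned on EXACTLY TWO clusters — node `TwoClusterFourPointPos`, PROVED `FourPointFKPos → TwoClusterFourPointPos`

Support file (`--supports stmt-CriticalPhenomena-4575`), FK sub-lane `prim-bschramm-fk-1` (gen 12) of the post-continuity programme;
builds on p205010 (kernel theorem, internal audit signed; external expert review pending).  Definitions (`levelTail`,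
`TwoClusterFourPointOn`, one `@[conjecture]` node — NOT asserted), no named facts, no sorries; standard axioms.

THE POINT.  For `φ_{w,q}` and an event `X` that forces at least two clusters (every pattern event with `a ↮ c` does:
`two_le_clusterCount_of_not_reachable`), `φ_{w,q}(X)·Z_{w,q} = Σ_j q^j·P_w(X ∩ L_j) = q²·T_X(q)` with the LEVEL TAIL
`T_X(q) = Σ_j q^{j−2} P_w(X ∩ L_j)` (`levelTail`; `real_mul_Z_eq_sq_mul_levelTail`), a polynomial with `T_X(0) = P_w(X ∩ L₂)` (`levelTail_zero`).
So the four-point inequality for EVERY `q > 0` gives `T₆(q)T₇(q) ≤ T₃(q)T₄(q)` for all `q > 0` and, letting `q → 0⁺`,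
**(two-cluster four-point) `P(X₆ ∩ L₂)·P(X₇ ∩ L₂) ≤ P(X₃ ∩ L₂)·P(X₄ ∩ L₂)`** — Kozma–Nitzan's four-point inequality for Bernoulli
percolation CONDITIONED ON EXACTLY TWO OPEN CLUSTERS (`X₆ = {oa|cb}`, `X₇ = {oc|ab}`, `X₃ = {oab|c}`, `X₄ = {ocb|a}`): with two clusters
`C_a ∋ a` and `C_c ∋ c`, the events `{o ∈ C_a}` and `{b ∈ C_a}` are POSITIVELY CORRELATED under the two-cluster law
`P(C_a = S) ∝ c_w(S)·c_w(V ∖ S)·∏_{e ∈ ∂S}(1 − w_e)` (`c_w` = probability of being connected).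
**`twoClusterFourPointPos_of_fourPointFKPos : FourPointFKPos → TwoClusterFourPointPos`** (kernel): the node is a NECESSARY condition of
the `q < 1` conjecture `FourPointFKPos`, stated purely for product measure at one level — cheap to census and a clean target.
EVIDENCE / STATUS (fk-1 g12, memo bschramm/FROM-fk-1-g12-SLACK-FOURPOINT.md §3, §7): (i) census: 0 violations in 44,650 placements on
random weighted graphs with 5–8 vertices (incl. near-deterministic palettes), whereas the same diagonal inequality at levels 3, 4, 5 fails
hundreds of times (it is only the two-cluster level that is clean); (ii) the further corner `w → 0` (uniform spanning 2-forests,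
`N(oab|c)N(ocb|a) ≥ N(oa|cb)N(oc|ab)`) is a THEOREM on paper by Wilson's algorithm (memo §3; census 0/53,100); (iii) at the two-cluster
level additive gluing for `|A| ≤ 2` follows from the node by the algebra of `…AllQGluing.lean` (not restated here).
[cite: KozmaNitzan2024, Thm. 1, eq. (6) (pp. 7–8)] [cite: Grimmett2006, §1.4 eq. (1.20) (p. 15); §1.2 eq. (1.1) (p. 4); §3.9 (pp. 63–65)]
-/

noncomputable section

namespace Summit.CriticalPhenomena.PercolationContinuityZ3.Theorems

namespace FK

open MeasureTheory Set Filter Topology Literature.Probability.LatticeModels Literature.Probability.Percolation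
open scoped Classical

variable {V : Type*} [Fintype V]

/-! ### Pattern events live at levels `≥ 2` -/

/-- **Two separated vertices force at least two open clusters**: `a ↮ c` in `ω` implies `2 ≤ k(ω)` (free count).
[cite: Grimmett2006, §1.2 eq. (1.1) (p. 4)] -/
theorem two_le_clusterCount_of_not_reachable {ω : BondConfig V} {a c : V} (h : ¬ (openGraph ω).Reachable a c) :
    2 ≤ clusterCount ω ∅ := by
  unfold clusterCount
  have hG : openGraph ω ⊔ wired (∅ : Set V) = openGraph ω := by rw [wired_empty, sup_bot_eq]
  have hne : (openGraph ω ⊔ wired (∅ : Set V)).connectedComponentMk a ≠ (openGraph ω ⊔ wired (∅ : Set V)).connectedComponentMk c := by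
    intro heq
    rw [SimpleGraph.ConnectedComponent.eq] at heq
    exact h (heq.mono (le_of_eq hG))
  haveI : Nontrivial (openGraph ω ⊔ wired (∅ : Set V)).ConnectedComponent := ⟨⟨_, _, hne⟩⟩
  exact Finite.one_lt_card

/-- An event inside `{a ↮ c}` misses the levels `0` and `1`. [cite: Grimmett2006, §1.2 eq. (1.1) (p. 4)] -/
theorem inter_levelSet_eq_empty_of_subset_sepEv {X : Set (BondConfig V)} {a c : V} (hX : X ⊆ sepEv a c) {j : ℕ} (hj : j < 2) :
    X ∩ levelSet V j = ∅ := by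
  ext ω
  simp only [mem_inter_iff, mem_levelSet_iff, mem_empty_iff_false, iff_false, not_and]
  intro hω hk
  have := two_le_clusterCount_of_not_reachable (hX hω)
  omega

/-! ### The level tail and the `q²` factorisation -/

/-- **Level tail** `T_X(q) = Σ_{j ≤ |V|} q^{j−2}·P_w(X ∩ L_j)` (natural-number subtraction in the exponent: the terms `j = 0, 1` carry `q⁰`,
and they vanish for events inside `{a ↮ c}`). [cite: Grimmett2006, §1.4 eq. (1.20) (p. 15)] -/
def levelTail (w : Sym2 V → unitInterval) (X : Set (BondConfig V)) (q : ℝ) : ℝ :=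
  ∑ j ∈ Finset.range (Fintype.card V + 1), q ^ (j - 2) * (prodBernoulli w).real (X ∩ levelSet V j)

/-- The level tail is a continuous (polynomial) function of `q`. [folklore] -/
theorem continuous_levelTail (w : Sym2 V → unitInterval) (X : Set (BondConfig V)) : Continuous (levelTail w X) := by
  unfold levelTail
  exact continuous_finsetSum _ fun j _ => (continuous_pow _).mul continuous_const

/-- **`T_X(0) = P_w(X ∩ L₂)`** for events inside `{a ↮ c}`. [cite: Grimmett2006, §1.2 eq. (1.1) (p. 4)] -/
theorem levelTail_zero (w : Sym2 V → unitInterval) {X : Set (BondConfig V)} {a c : V} (hX : X ⊆ sepEv a c) :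
    levelTail w X 0 = (prodBernoulli w).real (X ∩ levelSet V 2) := by
  unfold levelTail
  by_cases h2 : 2 ∈ Finset.range (Fintype.card V + 1)
  · rw [Finset.sum_eq_single 2]
    · simp
    · intro j _ hj
      rcases Nat.lt_or_gt_of_ne hj with hlt | hgt
      · rw [inter_levelSet_eq_empty_of_subset_sepEv hX hlt, measureReal_empty, mul_zero]
      · rw [zero_pow (by omega), zero_mul]
    · intro h; exact absurd h2 h
  · -- fewer than two vertices: both sides vanish
    have hcard : Fintype.card V < 2 := by
      rw [Finset.mem_range] at h2; omega
    have hL : X ∩ levelSet V 2 = ∅ := by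
      ext ω
      simp only [mem_inter_iff, mem_levelSet_iff, mem_empty_iff_false, iff_false, not_and]
      intro _ hk
      have := clusterCount_empty_le_card ω
      omega
    rw [hL, measureReal_empty]
    refine Finset.sum_eq_zero fun j hj => ?_
    rw [Finset.mem_range] at hj
    rw [inter_levelSet_eq_empty_of_subset_sepEv hX (by omega), measureReal_empty, mul_zero]

/-- **`φ_{w,q}(X)·Z_{w,q} = q²·T_X(q)`** for events inside `{a ↮ c}` (`q > 0`). [cite: Grimmett2006, §1.4 eq. (1.20) (p. 15)] -/
theorem real_mul_Z_eq_sq_mul_levelTail (w : Sym2 V → unitInterval) {q : ℝ} (hq : 0 < q) {X : Set (BondConfig V)} {a c : V}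
    (hX : X ⊆ sepEv a c) :
    (rcMeasureW w q ∅).real X * rcPartitionFunctionW w q ∅ = q ^ 2 * levelTail w X q := by
  have key := crMeasure_real_mul_eq_sum_levels w (h := fun k => q ^ k) (fun k => pow_pos hq k) X
  rw [crMeasure_pow_eq_rcMeasureW, crPartition_pow] at key
  rw [key]
  unfold levelTail
  rw [Finset.mul_sum]
  refine Finset.sum_congr rfl fun j _ => ?_
  rcases Nat.lt_or_ge j 2 with hj | hj
  · rw [inter_levelSet_eq_empty_of_subset_sepEv hX hj, measureReal_empty, mul_zero, mul_zero, mul_zero]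
  · rw [← mul_assoc, ← pow_add, show 2 + (j - 2) = j by omega]

/-! ### The node and the proved edge -/

/-- **Two-cluster four-point on the vertex type `V`**: for all weights and all `o, a, c, b`,
`P(X₆ ∩ L₂)·P(X₇ ∩ L₂) ≤ P(X₃ ∩ L₂)·P(X₄ ∩ L₂)` — Kozma–Nitzan's four-point inequality for Bernoulli percolation conditioned on exactly two
open clusters (positive correlation of `{o ∈ C_a}` and `{b ∈ C_a}` under the two-cluster law). [cite: KozmaNitzan2024, Thm. 1, eq. (6) (pp. 7–8)]
[cite: Grimmett2006, §1.2 eq. (1.1) (p. 4)] -/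
def TwoClusterFourPointOn (V : Type*) [Fintype V] : Prop :=
  ∀ (w : Sym2 V → unitInterval) (o a c b : V),
    (prodBernoulli w).real (openConn o a ∩ openConn b c ∩ sepEv a c ∩ levelSet V 2) *
        (prodBernoulli w).real (openConn o c ∩ openConn b a ∩ sepEv a c ∩ levelSet V 2) ≤
      (prodBernoulli w).real (openConn o a ∩ openConn b a ∩ sepEv a c ∩ levelSet V 2) *
        (prodBernoulli w).real (openConn o c ∩ openConn b c ∩ sepEv a c ∩ levelSet V 2)

/-- **Two-cluster four-point on every finite weighted graph.**  CONJECTURE-SHAPED STATEMENT about Bernoulli percolation, NOT asserted;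
a NECESSARY condition of `FourPointFKPos` (`twoClusterFourPointPos_of_fourPointFKPos`).  Evidence (fk-1 g12): 0 / 44,650 placements
(n = 5..8); the `w → 0` corner (uniform spanning 2-forests) is proved on paper by Wilson's algorithm; the analogous inequality at levels
3, 4, 5 is FALSE (hundreds of census failures). [cite: KozmaNitzan2024, Thm. 1 (p. 7)] [cite: Grimmett2006, §3.9 (pp. 63–65)] -/
@[conjecture] def TwoClusterFourPointPos : Prop := ∀ n : ℕ, TwoClusterFourPointOn (Fin n)

omit [Fintype V] in
/-- Pattern events lie inside `{a ↮ c}`. [folklore] -/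
theorem pattern_subset_sepEv (X Y : Set (BondConfig V)) (a c : V) : X ∩ Y ∩ sepEv a c ⊆ (sepEv a c : Set (BondConfig V)) :=
  fun _ hω => hω.2

/-- **`FourPointFK q` for all `q > 0` at one placement ⇒ the two-cluster four-point inequality there** (`q → 0⁺`).
[cite: KozmaNitzan2024, Thm. 1 (p. 7)] [cite: Grimmett2006, §1.4 eq. (1.20) (p. 15)] -/
theorem twoCluster_fourPoint_of_forall_fourPointFK (w : Sym2 V → unitInterval) (o a c b : V)
    (h : ∀ q : ℝ, 0 < q → FourPointUnder (rcMeasureW w q ∅) o a c b) :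
    (prodBernoulli w).real (openConn o a ∩ openConn b c ∩ sepEv a c ∩ levelSet V 2) *
        (prodBernoulli w).real (openConn o c ∩ openConn b a ∩ sepEv a c ∩ levelSet V 2) ≤
      (prodBernoulli w).real (openConn o a ∩ openConn b a ∩ sepEv a c ∩ levelSet V 2) *
        (prodBernoulli w).real (openConn o c ∩ openConn b c ∩ sepEv a c ∩ levelSet V 2) := by
  set X₆ : Set (BondConfig V) := openConn o a ∩ openConn b c ∩ sepEv a c
  set X₇ : Set (BondConfig V) := openConn o c ∩ openConn b a ∩ sepEv a c
  set X₃ : Set (BondConfig V) := openConn o a ∩ openConn b a ∩ sepEv a c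
  set X₄ : Set (BondConfig V) := openConn o c ∩ openConn b c ∩ sepEv a c
  have h₆ : X₆ ⊆ sepEv a c := pattern_subset_sepEv _ _ a c
  have h₇ : X₇ ⊆ sepEv a c := pattern_subset_sepEv _ _ a c
  have h₃ : X₃ ⊆ sepEv a c := pattern_subset_sepEv _ _ a c
  have h₄ : X₄ ⊆ sepEv a c := pattern_subset_sepEv _ _ a c
  -- the tails satisfy the inequality for every `q > 0`
  set F : ℝ → ℝ := fun q => levelTail w X₃ q * levelTail w X₄ q - levelTail w X₆ q * levelTail w X₇ q with hF
  have hFq : ∀ q : ℝ, 0 < q → 0 ≤ F q := by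
    intro q hq
    have hZ : 0 < rcPartitionFunctionW w q ∅ := by
      rw [← crPartition_pow]; exact crPartition_pos w fun k => pow_pos hq k
    have h4 := h q hq
    unfold FourPointUnder at h4
    -- multiply by `Z²` and factor `q²` out of each mass
    have h4' : ((rcMeasureW w q ∅).real X₆ * rcPartitionFunctionW w q ∅) * ((rcMeasureW w q ∅).real X₇ * rcPartitionFunctionW w q ∅) ≤
        ((rcMeasureW w q ∅).real X₃ * rcPartitionFunctionW w q ∅) * ((rcMeasureW w q ∅).real X₄ * rcPartitionFunctionW w q ∅) := by
      have := mul_le_mul_of_nonneg_right h4 (mul_nonneg hZ.le hZ.le)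
      calc _ = (rcMeasureW w q ∅).real X₆ * (rcMeasureW w q ∅).real X₇ * (rcPartitionFunctionW w q ∅ * rcPartitionFunctionW w q ∅) := by ring
        _ ≤ (rcMeasureW w q ∅).real X₃ * (rcMeasureW w q ∅).real X₄ * (rcPartitionFunctionW w q ∅ * rcPartitionFunctionW w q ∅) := this
        _ = _ := by ring
    rw [real_mul_Z_eq_sq_mul_levelTail w hq h₆, real_mul_Z_eq_sq_mul_levelTail w hq h₇, real_mul_Z_eq_sq_mul_levelTail w hq h₃,
      real_mul_Z_eq_sq_mul_levelTail w hq h₄] at h4'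
    have hq4 : 0 < q ^ 2 * q ^ 2 := by positivity
    have : q ^ 2 * q ^ 2 * (levelTail w X₆ q * levelTail w X₇ q) ≤ q ^ 2 * q ^ 2 * (levelTail w X₃ q * levelTail w X₄ q) := by
      nlinarith [h4']
    have := le_of_mul_le_mul_left this hq4
    simp only [hF]; linarith
  -- continuity at `0` along `q = 1/(n+1)`
  have hcont : Continuous F := by
    simp only [hF]
    exact ((continuous_levelTail w X₃).mul (continuous_levelTail w X₄)).sub
      ((continuous_levelTail w X₆).mul (continuous_levelTail w X₇))
  have hlim : Tendsto (fun n : ℕ => F (1 / ((n : ℝ) + 1))) atTop (𝓝 (F 0)) :=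
    (hcont.tendsto 0).comp tendsto_one_div_add_atTop_nhds_zero_nat
  have hF0 : 0 ≤ F 0 := ge_of_tendsto' hlim fun n => hFq _ (by positivity)
  simp only [hF, levelTail_zero w h₃, levelTail_zero w h₄, levelTail_zero w h₆, levelTail_zero w h₇] at hF0
  linarith

/-- **`FourPointFKPos → TwoClusterFourPointPos`**: the two-cluster four-point inequality for Bernoulli percolation is a necessary condition
of the four-point inequality for every `φ_{w,q}`, `q > 0`. [cite: KozmaNitzan2024, Thm. 1 (p. 7)] [cite: Grimmett2006, §3.9 (pp. 63–65)] -/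
theorem twoClusterFourPointPos_of_fourPointFKPos (h : FourPointFKPos) : TwoClusterFourPointPos :=
  fun n w o a c b => twoCluster_fourPoint_of_forall_fourPointFK w o a c b fun q hq => h q hq n w o a c b

end FK

end Summit.CriticalPhenomena.PercolationContinuityZ3.Theorems

end
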